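import Literature.NumberTheory.Automorphic.UnitaryRankOneSatakeClassical
import Literature.NumberTheory.Automorphic.HyperspecialUnitaryHeckeEigencharacter
import HarnessLib

/-!
# The unramified characters of `ℋ(U(2), K₀)`, `ℋ(U(3), K₀)`: every algebra homomorphism `ℋ → ℂ` is a Hecke eigencharacter
# `λ_β`, and `λ_β = λ_{β'}` iff the Satake parameters agree up to `W` (`z' ∈ {z, z⁻¹}`); the spherical Hecke algebra is a
# polynomial algebra in one Hecke operator (Cartier Cor. 4.2; Rogawski §4.5; Mínguez §4)

Topic `NumberTheory/Automorphic`; namespace `Literature.NumberTheory.Automorphic.HermitianLattice[.UnramifiedLocalConjDatum]`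
(lane `lit-hodgefound`, Track 2 foundations; seat `lit-hodgefound-p11`, generation 46, row g46-#5).  THEOREMS ONLY: no definition,
no named fact, no instance, no notation.  Sequel of `UnitaryRankOneSatakeClassical` (g46-#3: `range 𝒮 = ℂ[Λ⁻]^W`, `𝒮` injective)
and of `HyperspecialUnitaryHeckeEigencharacter` (g36-#9: `λ_β = ev_β ∘ 𝒮 : ℋ →ₐ[ℂ] ℂ`).

## The mathematics

Abstractly (§1–§2): let `Λ⁻ = {ℓ_m : m ∈ ℤ} ⊂ ℤ^N` be a LINE through the antisymmetric lattice (`ℓ` additive, `(ℓ_m)_0 = m`,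
every antisymmetric `μ` equal to `ℓ_{μ_0}`; `N = 2`: `ℓ_m = (m, -m)`, `N = 3`: `ℓ_m = (m, 0, -m)`), and
`A = {g ∈ R[ℤ^N] : g = 0 off Λ⁻, g_{-μ} = g_μ}` the `W`-invariants.  With `X = x^{ℓ_1} + x^{ℓ_{-1}}` and `p_k = x^{ℓ_k} + x^{ℓ_{-k}}`
one has `X · p_k = p_{k+1} + p_{k-1}` (`single_line_mul_p`), so `p_k = Q_k(X)` for the Chebyshev-type polynomials `Q_0 = 2`,
`Q_1 = t`, `Q_{k+2} = t Q_{k+1} - Q_k` (`exists_aeval_eq_p`), and by induction on the top exponent **every `g ∈ A` is a polynomial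
in `X`** (`exists_aeval_eq_of_mem_invariants`): `A = R[X]`.  Consequently (§2), whenever the Satake transform
`𝒮 : ℋ(U(σ, J₀), K₀) → ℂ[ℤ^N]` has `range 𝒮 = A` (g46-#3 for `N = 2, 3`), the Hecke operator `T₁` with `𝒮(T₁) = X` GENERATES:
**every `T ∈ ℋ` is `P(T₁)` for a polynomial `P`** (`exists_aeval_eq_of_range_eq`; Cartier: `ℋ(G, K) ≅ ℂ[Λ]^W` is a polynomial
algebra), two algebra homomorphisms `ℋ → B` agreeing on `T₁` are equal (`algHom_ext_of_range_eq`), and for every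
`χ : ℋ →ₐ[ℂ] ℂ`: choosing `z ∈ ℂˣ` with `z + z⁻¹ = χ(T₁)` (`exists_units_add_inv_eq`) and `β = (z, 1, …, 1)`, the eigencharacter
`λ_β` (value `z + z⁻¹` on `T₁`, `heckeEigencharacter_apply_generator`) equals `χ` — **every unramified character is a `λ_β`**
(`exists_heckeEigencharacter_eq_of_range_eq`; Cartier Cor. 4.2 «the algebra homomorphisms `ℋ(G, K) → ℂ` are the `f ↦ Sf(χ)`»),
and **`λ_β = λ_{β'}` iff `z(β') = z(β)` or `z(β') = z(β)⁻¹`**, `z(β) = ∏_i β_i^{(ℓ_1)_i}` (`heckeEigencharacter_eq_iff_of_range_eq`;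
the unramified dual is `ℂˣ/(z ∼ z⁻¹)`, Rogawski §4.5: unramified `σ_w` «corresponds to [a] class of unramified characters of `T`
under conjugacy by the Weyl group»).  §3 instantiates: `U(3)` (`z(β) = β₀ β₂⁻¹`) and `U(2)` (`z(β) = β₀ β₁⁻¹`), for
`hd : UnramifiedLocalConjDatum σ ϖ` with `σ ≠ id` and finite residue field.

## What is formalised (theorems only)

* §1 (`R[ℤ^N]`, abstract line) `line_zero`, `line_neg`, `single_line_mul_single_line`, `single_line_mul_p`, `exists_aeval_eq_p`,
  `coeff_algebraMap`, **`exists_aeval_eq_of_mem_invariants`**, `single_line_add_mem_invariants` (`X ∈ A`).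
* §2 (any `N`, hypothesis `range 𝒮 = A`) **`exists_aeval_eq_of_range_eq`**, **`algHom_ext_of_range_eq`**, `exists_units_add_inv_eq`,
  `eq_or_eq_inv_of_add_inv_eq`, `laurentEvalAt_single_line_add`, **`exists_heckeEigencharacter_eq_of_range_eq`**,
  **`heckeEigencharacter_eq_iff_of_range_eq`**.
* §3 **`exists_heckeEigencharacter_eq_three/two`**, **`heckeEigencharacter_eq_iff_three/two`**, `exists_generator_three/two`
  (`ℋ = ℂ[T₁]`).

## References
* [CartierCorvallis1979] P. Cartier, *Representations of 𝔭-adic groups: a survey*, PSPM 33.1 (1979), §IV (4.2)–(4.4), Thm. 4.1,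
  Cor. 4.2 (the unramified characters of `ℋ(G, K)`).
* [Rogawski1990] J. D. Rogawski, *Automorphic Representations of Unitary Groups in Three Variables*, Ann. of Math. Stud. 123
  (1990), §4.5 p. 50; §2.3 p. 21 (unramified `σ_w` ↔ `W`-class of unramified characters of `T`).
* [Minguez2011] A. Mínguez, *Unramified representations of unitary groups*, in: *On the stabilization of the trace formula*
  (2011), §4.
* [Satake1963] I. Satake, Publ. Math. IHÉS 18 (1963), §§6–7.
-/

noncomputable section

open scoped Valued WithZero Matrix MatrixGroups Pointwise
open MonoidAlgebra Representation Finset MulAction ConjAct Polynomial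

namespace Literature.NumberTheory.Automorphic.HermitianLattice

open Literature.NumberTheory.Automorphic.CartanUnique Literature.NumberTheory.Automorphic.SymplecticCartan
  Literature.NumberTheory.Automorphic

/-! ## §1 `R[Λ⁻]^W = R[X]`, `X = x^{ℓ_1} + x^{ℓ_{-1}}`, for a line `ℓ` -/

section Line

variable {N : ℕ} {R : Type*} [CommRing R] {ℓ : ℤ → Fin N → ℤ}

/-- `ℓ_0 = 0` for an additive line. [cite: CartierCorvallis1979, §IV (4.2)] -/
theorem line_zero (hadd : ∀ a b, ℓ (a + b) = ℓ a + ℓ b) : ℓ 0 = 0 := by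
  have h := hadd 0 0
  rw [add_zero] at h
  exact left_eq_add.1 h

/-- `ℓ_{-a} = -ℓ_a` for an additive line. [cite: CartierCorvallis1979, §IV (4.2)] -/
theorem line_neg (hadd : ∀ a b, ℓ (a + b) = ℓ a + ℓ b) (a : ℤ) : ℓ (-a) = -ℓ a := by
  have h := hadd a (-a)
  rw [add_neg_cancel, line_zero hadd] at h
  exact (neg_eq_of_add_eq_zero_right h.symm).symm

/-- `x^{ℓ_a} · x^{ℓ_b} = x^{ℓ_c}` for `a + b = c`. [cite: CartierCorvallis1979, §IV (4.2)] -/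
theorem single_line_mul_single_line (hadd : ∀ a b, ℓ (a + b) = ℓ a + ℓ b) {a b c : ℤ} (h : a + b = c) (r s : R) :
    AddMonoidAlgebra.single (ℓ a) r * AddMonoidAlgebra.single (ℓ b) s = AddMonoidAlgebra.single (ℓ c) (r * s) := by
  rw [AddMonoidAlgebra.single_mul_single, ← hadd, h]

/-- **`X · p_k = p_{k+1} + p_{k-1}`** for `X = x^{ℓ_1} + x^{ℓ_{-1}}`, `p_k = x^{ℓ_k} + x^{ℓ_{-k}}`. [cite: CartierCorvallis1979, §IV (4.2)] -/
theorem single_line_mul_p (hadd : ∀ a b, ℓ (a + b) = ℓ a + ℓ b) (k : ℤ) :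
    (AddMonoidAlgebra.single (ℓ 1) (1 : R) + AddMonoidAlgebra.single (ℓ (-1)) 1) *
        (AddMonoidAlgebra.single (ℓ k) 1 + AddMonoidAlgebra.single (ℓ (-k)) 1) =
      (AddMonoidAlgebra.single (ℓ (k + 1)) 1 + AddMonoidAlgebra.single (ℓ (-(k + 1))) 1) +
        (AddMonoidAlgebra.single (ℓ (k - 1)) 1 + AddMonoidAlgebra.single (ℓ (-(k - 1))) 1) := by
  rw [add_mul, mul_add, mul_add, single_line_mul_single_line hadd (show 1 + k = k + 1 by ring),
    single_line_mul_single_line hadd (show 1 + -k = -(k - 1) by ring), single_line_mul_single_line hadd (show -1 + k = k - 1 by ring),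
    single_line_mul_single_line hadd (show -1 + -k = -(k + 1) by ring), one_mul]
  abel

/-- **`p_k = Q_k(X)`**: every `p_k = x^{ℓ_k} + x^{ℓ_{-k}}` (`k ∈ ℕ`) is a polynomial in `X` (`Q_0 = 2`, `Q_1 = t`,
`Q_{k+2} = t Q_{k+1} - Q_k`). [cite: CartierCorvallis1979, §IV (4.2), Thm. 4.1] -/
theorem exists_aeval_eq_p (hadd : ∀ a b, ℓ (a + b) = ℓ a + ℓ b) (k : ℕ) :
    ∃ Q : R[X], aeval (AddMonoidAlgebra.single (ℓ 1) (1 : R) + AddMonoidAlgebra.single (ℓ (-1)) 1) Q =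
      AddMonoidAlgebra.single (ℓ k) 1 + AddMonoidAlgebra.single (ℓ (-(k : ℤ))) 1 := by
  induction k using Nat.twoStepInduction with
  | zero =>
    refine ⟨C 2, ?_⟩
    rw [aeval_C, Algebra.algebraMap_eq_smul_one, AddMonoidAlgebra.one_def, Nat.cast_zero, neg_zero, line_zero hadd, ← two_smul R]
  | one => exact ⟨Polynomial.X, by rw [aeval_X, Nat.cast_one]⟩
  | more k h0 h1 =>
    obtain ⟨Q₀, hQ₀⟩ := h0
    obtain ⟨Q₁, hQ₁⟩ := h1
    refine ⟨Polynomial.X * Q₁ - Q₀, ?_⟩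
    rw [map_sub, map_mul, aeval_X, hQ₁, hQ₀, single_line_mul_p hadd]
    have e1 : ((k + 1 : ℕ) : ℤ) + 1 = ((k + 2 : ℕ) : ℤ) := by push_cast; ring
    have e2 : ((k + 1 : ℕ) : ℤ) - 1 = ((k : ℕ) : ℤ) := by push_cast; ring
    rw [e1, e2, add_sub_cancel_right]

/-- Coefficients of a scalar: `(c · 1)_μ = c` for `μ = 0` and `0` otherwise. [folklore] -/
private theorem coeff_algebraMap (c : R) (μ : Fin N → ℤ) :
    (algebraMap R (AddMonoidAlgebra R (Fin N → ℤ)) c).coeff μ = if (0 : Fin N → ℤ) = μ then c else 0 := by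
  rw [Algebra.algebraMap_eq_smul_one, AddMonoidAlgebra.one_def, AddMonoidAlgebra.coeff_smul, Finsupp.smul_apply,
    AddMonoidAlgebra.coeff_single, Finsupp.single_apply, smul_eq_mul, mul_ite, mul_one, mul_zero]

variable [NeZero N]

/-- **`R[Λ⁻]^W = R[X]`**: every `g ∈ R[ℤ^N]` vanishing off the line `Λ⁻ = {ℓ_m}` (= the antisymmetric lattice) and symmetric
under `μ ↦ -μ` is a polynomial in `X = x^{ℓ_1} + x^{ℓ_{-1}}` (induction on the top exponent: subtract `g_{ℓ_n} · p_n`).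
[cite: CartierCorvallis1979, §IV (4.2), Thm. 4.1] [cite: Satake1963, §§6–7] -/
theorem exists_aeval_eq_of_mem_invariants (hadd : ∀ a b, ℓ (a + b) = ℓ a + ℓ b) (hℓ0 : ∀ m, ℓ m 0 = m)
    (hℓrev : ∀ m i, ℓ m (Fin.rev i) = -ℓ m i) (hℓ : ∀ μ : Fin N → ℤ, (∀ i, μ (Fin.rev i) = -μ i) → μ = ℓ (μ 0))
    (g : AddMonoidAlgebra R (Fin N → ℤ)) (hg₁ : ∀ μ : Fin N → ℤ, (¬ ∀ i, μ (Fin.rev i) = -μ i) → g.coeff μ = 0)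
    (hg₂ : ∀ μ : Fin N → ℤ, g.coeff (-μ) = g.coeff μ) :
    ∃ P : R[X], aeval (AddMonoidAlgebra.single (ℓ 1) (1 : R) + AddMonoidAlgebra.single (ℓ (-1)) 1) P = g := by
  classical
  -- induction on the top exponent
  suffices key : ∀ (n : ℕ) (g : AddMonoidAlgebra R (Fin N → ℤ)),
      (∀ μ : Fin N → ℤ, (¬ ∀ i, μ (Fin.rev i) = -μ i) → g.coeff μ = 0) → (∀ μ : Fin N → ℤ, g.coeff (-μ) = g.coeff μ) →
      (∀ μ : Fin N → ℤ, (n : ℤ) < μ 0 → g.coeff μ = 0) →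
      ∃ P : R[X], aeval (AddMonoidAlgebra.single (ℓ 1) (1 : R) + AddMonoidAlgebra.single (ℓ (-1)) 1) P = g by
    refine key (g.coeff.support.sup fun μ => (μ 0).toNat) g hg₁ hg₂ fun μ hμ => ?_
    by_contra hne
    have hmem : μ ∈ g.coeff.support := Finsupp.mem_support_iff.2 hne
    have hle : (μ 0).toNat ≤ g.coeff.support.sup fun μ => (μ 0).toNat := Finset.le_sup (f := fun μ => (μ 0).toNat) hmem
    have := Int.self_le_toNat (μ 0)
    omega
  intro n
  induction n with
  | zero =>
    intro g hg₁ hg₂ hsupp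
    refine ⟨C (g.coeff 0), ?_⟩
    rw [aeval_C]
    refine AddMonoidAlgebra.ext (Finsupp.ext fun μ => ?_)
    rw [coeff_algebraMap]
    by_cases hμ0 : (0 : Fin N → ℤ) = μ
    · rw [if_pos hμ0, hμ0]
    · rw [if_neg hμ0]
      by_cases hrev : ∀ i, μ (Fin.rev i) = -μ i
      · have hμ : μ 0 ≠ 0 := fun h => hμ0 (by rw [hℓ μ hrev, h, line_zero hadd])
        rcases lt_or_gt_of_ne hμ with hlt | hgt
        · rw [← hg₂ μ, hsupp (-μ) (by rw [Pi.neg_apply, Nat.cast_zero]; omega)]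
        · rw [hsupp μ (by rw [Nat.cast_zero]; exact hgt)]
      · rw [hg₁ μ hrev]
  | succ n ih =>
    intro g hg₁ hg₂ hsupp
    set c : R := g.coeff (ℓ ((n : ℤ) + 1)) with hc
    set p : AddMonoidAlgebra R (Fin N → ℤ) :=
      AddMonoidAlgebra.single (ℓ ((n : ℤ) + 1)) 1 + AddMonoidAlgebra.single (ℓ (-((n : ℤ) + 1))) 1 with hp
    have hpcoeff : ∀ μ : Fin N → ℤ, p.coeff μ =
        (if ℓ ((n : ℤ) + 1) = μ then 1 else 0) + (if ℓ (-((n : ℤ) + 1)) = μ then 1 else 0) := fun μ => by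
      rw [hp, AddMonoidAlgebra.coeff_add, Finsupp.add_apply, AddMonoidAlgebra.coeff_single, AddMonoidAlgebra.coeff_single,
        Finsupp.single_apply, Finsupp.single_apply]
    have hgc : ∀ μ : Fin N → ℤ, (g - c • p).coeff μ = g.coeff μ - c * p.coeff μ := fun μ => by
      rw [AddMonoidAlgebra.coeff_sub, Finsupp.sub_apply, AddMonoidAlgebra.coeff_smul, Finsupp.smul_apply, smul_eq_mul]
    -- the values of `ℓ` are antisymmetric with prescribed `0`-coordinate
    have hℓne : ∀ (a : ℤ) (μ : Fin N → ℤ), μ 0 ≠ a → ℓ a ≠ μ := fun a μ h e => h (by rw [← e, hℓ0])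
    have hℓne' : ∀ (a : ℤ) (μ : Fin N → ℤ), (¬ ∀ i, μ (Fin.rev i) = -μ i) → ℓ a ≠ μ := fun a μ h e => h (by rw [← e]; exact hℓrev a)
    obtain ⟨P', hP'⟩ := ih (g - c • p)
      (fun μ hμ => by rw [hgc, hpcoeff, hg₁ μ hμ, if_neg (hℓne' _ μ hμ), if_neg (hℓne' _ μ hμ), add_zero, mul_zero, sub_zero])
      (fun μ => by
        rw [hgc, hgc, hpcoeff, hpcoeff, hg₂ μ]
        congr 2
        rw [add_comm]
        congr 1
        · refine if_congr ⟨fun h => ?_, fun h => ?_⟩ rfl rfl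
          · rw [← neg_neg μ, ← h, ← line_neg hadd, neg_neg]
          · rw [← h, ← line_neg hadd]
        · refine if_congr ⟨fun h => ?_, fun h => ?_⟩ rfl rfl
          · rw [← neg_neg μ, ← h, ← line_neg hadd]
          · rw [← h, ← line_neg hadd, neg_neg])
      (fun μ hμ => by
        rw [hgc, hpcoeff]
        rcases lt_or_eq_of_le (show (n : ℤ) + 1 ≤ μ 0 by omega) with hlt | heq
        · rw [hsupp μ (by push_cast; exact hlt), if_neg (hℓne _ μ (by omega)), if_neg (hℓne _ μ (by omega)), add_zero, mul_zero,
            sub_zero]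
        · by_cases hrev : ∀ i, μ (Fin.rev i) = -μ i
          · have hμ' : μ = ℓ ((n : ℤ) + 1) := by rw [hℓ μ hrev, heq]
            rw [if_pos hμ'.symm, if_neg (hℓne _ μ (by omega)), add_zero, mul_one, hμ', ← hc, sub_self]
          · rw [hg₁ μ hrev, if_neg (hℓne' _ μ hrev), if_neg (hℓne' _ μ hrev), add_zero, mul_zero, sub_zero])
    obtain ⟨Q, hQ⟩ := exists_aeval_eq_p (R := R) hadd (n + 1)
    refine ⟨P' + C c * Q, ?_⟩
    rw [map_add, map_mul, aeval_C, hP', hQ, ← Algebra.smul_def, Nat.cast_succ, ← hp, sub_add_cancel]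

omit [NeZero N] in
/-- `X = x^{ℓ_1} + x^{ℓ_{-1}}` lies in `R[Λ⁻]^W`: it vanishes off the antisymmetric lattice and is symmetric.
[cite: CartierCorvallis1979, §IV (4.2)] -/
theorem single_line_add_mem_invariants (hadd : ∀ a b, ℓ (a + b) = ℓ a + ℓ b) (hℓrev : ∀ m i, ℓ m (Fin.rev i) = -ℓ m i) :
    (∀ μ : Fin N → ℤ, (¬ ∀ i, μ (Fin.rev i) = -μ i) →
      (AddMonoidAlgebra.single (ℓ 1) (1 : R) + AddMonoidAlgebra.single (ℓ (-1)) 1).coeff μ = 0) ∧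
    ∀ μ : Fin N → ℤ, (AddMonoidAlgebra.single (ℓ 1) (1 : R) + AddMonoidAlgebra.single (ℓ (-1)) 1).coeff (-μ) =
      (AddMonoidAlgebra.single (ℓ 1) (1 : R) + AddMonoidAlgebra.single (ℓ (-1)) 1).coeff μ := by
  classical
  have hcoeff : ∀ μ : Fin N → ℤ, (AddMonoidAlgebra.single (ℓ 1) (1 : R) + AddMonoidAlgebra.single (ℓ (-1)) 1).coeff μ =
      (if ℓ 1 = μ then 1 else 0) + (if ℓ (-1) = μ then 1 else 0) := fun μ => by
    rw [AddMonoidAlgebra.coeff_add, Finsupp.add_apply, AddMonoidAlgebra.coeff_single, AddMonoidAlgebra.coeff_single,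
      Finsupp.single_apply, Finsupp.single_apply]
  refine ⟨fun μ hμ => ?_, fun μ => ?_⟩
  · have hne : ∀ a : ℤ, ℓ a ≠ μ := fun a e => hμ (by rw [← e]; exact hℓrev a)
    rw [hcoeff, if_neg (hne _), if_neg (hne _), add_zero]
  · rw [hcoeff, hcoeff, add_comm]
    congr 1
    · refine if_congr ⟨fun h => ?_, fun h => ?_⟩ rfl rfl
      · rw [← neg_neg μ, ← h, ← line_neg hadd, neg_neg]
      · rw [← h, ← line_neg hadd]
    · refine if_congr ⟨fun h => ?_, fun h => ?_⟩ rfl rfl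
      · rw [← neg_neg μ, ← h, ← line_neg hadd]
      · rw [← h, ← line_neg hadd, neg_neg]

end Line

/-! ## §2 Consequences of `range 𝒮 = ℂ[Λ⁻]^W`: a generator of `ℋ`, and the unramified characters -/


/-- `z + z⁻¹ = c` has a solution `z ∈ ℂˣ` (a root of `t² - c t + 1`). [cite: CartierCorvallis1979, §IV Cor. 4.2] -/
theorem exists_units_add_inv_eq (c : ℂ) : ∃ z : ℂˣ, (z : ℂ) + (z : ℂ)⁻¹ = c := by
  have hdeg : 0 < degree (C (1 : ℂ) * Polynomial.X ^ 2 + C (-c) * Polynomial.X + C 1) := by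
    rw [degree_quadratic one_ne_zero]; norm_num
  obtain ⟨z, hz⟩ := Complex.exists_root hdeg
  simp only [IsRoot.def, eval_add, eval_mul, eval_C, eval_pow, eval_X, one_mul, neg_mul] at hz
  have hz0 : z ≠ 0 := fun h => by rw [h] at hz; norm_num at hz
  refine ⟨Units.mk0 z hz0, ?_⟩
  rw [Units.val_mk0]
  field_simp
  linear_combination hz

/-- `z + z⁻¹ = w + w⁻¹` for `z, w ≠ 0` forces `w = z` or `w = z⁻¹`. [cite: CartierCorvallis1979, §IV Cor. 4.2] -/
theorem eq_or_eq_inv_of_add_inv_eq {z w : ℂ} (hz : z ≠ 0) (hw : w ≠ 0) (h : z + z⁻¹ = w + w⁻¹) : w = z ∨ w = z⁻¹ := by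
  have key : (w - z) * (w * z - 1) = 0 := by
    field_simp at h
    linear_combination -h
  rcases mul_eq_zero.1 key with h1 | h2
  · exact Or.inl (sub_eq_zero.1 h1)
  · exact Or.inr (eq_inv_of_mul_eq_one_left (sub_eq_zero.1 h2))

variable {K : Type*} [Field K] [Valued K ℤᵐ⁰] {σ : K →+* K} {ϖ : K} {N : ℕ}

/-- **`ev_β(X) = z + z⁻¹`**, `z = ∏_i β_i^{(ℓ_1)_i}`, for `X = x^{ℓ_1} + x^{ℓ_{-1}}` and an additive line `ℓ`.
[cite: CartierCorvallis1979, §IV (4.2)–(4.4)] -/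
theorem laurentEvalAt_single_line_add {ℓ : ℤ → Fin N → ℤ} (hadd : ∀ a b, ℓ (a + b) = ℓ a + ℓ b) (β : Fin N → ℂˣ) :
    laurentEvalAt β (AddMonoidAlgebra.single (ℓ 1) (1 : ℂ) + AddMonoidAlgebra.single (ℓ (-1)) 1) =
      (∏ i, ((β i : ℂ) ^ ℓ 1 i)) + (∏ i, ((β i : ℂ) ^ ℓ 1 i))⁻¹ := by
  rw [map_add, laurentEvalAt_single, laurentEvalAt_single, one_mul, one_mul, line_neg hadd, ← Finset.prod_inv_distrib]
  congr 1
  exact Finset.prod_congr rfl fun i _ => by rw [Pi.neg_apply, zpow_neg]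

namespace UnramifiedLocalConjDatum

section Abstract

variable [Finite 𝓀[K]] (hd : UnramifiedLocalConjDatum σ ϖ) {ℓ : ℤ → Fin N → ℤ} (hadd : ∀ a b, ℓ (a + b) = ℓ a + ℓ b)
include hadd

/-- `λ_β(T₁) = z(β) + z(β)⁻¹`, `z(β) = ∏_i β_i^{(ℓ_1)_i}`, for `𝒮(T₁) = X`. [cite: CartierCorvallis1979, §IV (4.2)–(4.4)] -/
theorem heckeEigencharacter_apply_generator
    {T₁ : heckeAlgebra ℂ (unitaryGroupOfForm σ ((StdForm.antidiagonal N).over K)) (unitaryInt σ ((StdForm.antidiagonal N).over K))}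
    (hT₁ : hd.satakeTransform T₁ = AddMonoidAlgebra.single (ℓ 1) (1 : ℂ) + AddMonoidAlgebra.single (ℓ (-1)) 1) (β : Fin N → ℂˣ) :
    hd.heckeEigencharacter β T₁ = (∏ i, ((β i : ℂ) ^ ℓ 1 i)) + (∏ i, ((β i : ℂ) ^ ℓ 1 i))⁻¹ := by
  rw [hd.heckeEigencharacter_apply, hT₁, laurentEvalAt_single_line_add hadd]

variable [NeZero N] (hℓ0 : ∀ m, ℓ m 0 = m) (hℓrev : ∀ m i, ℓ m (Fin.rev i) = -ℓ m i)
  (hℓ : ∀ μ : Fin N → ℤ, (∀ i, μ (Fin.rev i) = -μ i) → μ = ℓ (μ 0))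
  (hrange : Set.range (hd.satakeTransform (N := N)) =
    {g | (∀ μ : Fin N → ℤ, (¬ ∀ i, μ (Fin.rev i) = -μ i) → g.coeff μ = 0) ∧ ∀ μ : Fin N → ℤ, g.coeff (-μ) = g.coeff μ})
include hℓ0 hℓrev hℓ hrange

/-- **`ℋ(U(σ, J₀), K₀) = ℂ[T₁]`**: if `range 𝒮 = ℂ[Λ⁻]^W` for a line `Λ⁻`, there is a Hecke operator `T₁` (the one with `𝒮(T₁) = X`)
such that every `T ∈ ℋ` is a polynomial in `T₁`. [cite: CartierCorvallis1979, §IV Thm. 4.1, Cor. 4.2] [cite: Satake1963, §§6–7] -/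
theorem exists_aeval_eq_of_range_eq :
    ∃ T₁ : heckeAlgebra ℂ (unitaryGroupOfForm σ ((StdForm.antidiagonal N).over K)) (unitaryInt σ ((StdForm.antidiagonal N).over K)),
      hd.satakeTransform T₁ = AddMonoidAlgebra.single (ℓ 1) (1 : ℂ) + AddMonoidAlgebra.single (ℓ (-1)) 1 ∧
      ∀ T, ∃ P : ℂ[X], aeval T₁ P = T := by
  have hX : AddMonoidAlgebra.single (ℓ 1) (1 : ℂ) + AddMonoidAlgebra.single (ℓ (-1)) 1 ∈ Set.range (hd.satakeTransform (N := N)) := by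
    rw [hrange]
    exact single_line_add_mem_invariants hadd hℓrev
  obtain ⟨T₁, hT₁⟩ := hX
  refine ⟨T₁, hT₁, fun T => ?_⟩
  have hT : hd.satakeTransform T ∈ Set.range (hd.satakeTransform (N := N)) := ⟨T, rfl⟩
  rw [hrange] at hT
  obtain ⟨P, hP⟩ := exists_aeval_eq_of_mem_invariants hadd hℓ0 hℓrev hℓ (hd.satakeTransform T) hT.1 hT.2
  refine ⟨P, hd.satakeTransform_injective ?_⟩
  rw [← aeval_algHom_apply, hT₁, hP]

/-- Two algebra homomorphisms `ℋ(U(σ, J₀), K₀) → B` that agree on the generator `T₁` are equal.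
[cite: CartierCorvallis1979, §IV Cor. 4.2] -/
theorem algHom_ext_of_range_eq {B : Type*} [Semiring B] [Algebra ℂ B]
    {T₁ : heckeAlgebra ℂ (unitaryGroupOfForm σ ((StdForm.antidiagonal N).over K)) (unitaryInt σ ((StdForm.antidiagonal N).over K))}
    (hT₁ : hd.satakeTransform T₁ = AddMonoidAlgebra.single (ℓ 1) (1 : ℂ) + AddMonoidAlgebra.single (ℓ (-1)) 1)
    {χ χ' : heckeAlgebra ℂ (unitaryGroupOfForm σ ((StdForm.antidiagonal N).over K)) (unitaryInt σ ((StdForm.antidiagonal N).over K)) →ₐ[ℂ] B}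
    (h : χ T₁ = χ' T₁) : χ = χ' := by
  refine AlgHom.ext fun T => ?_
  obtain ⟨T₁', hT₁', hgen⟩ := hd.exists_aeval_eq_of_range_eq hadd hℓ0 hℓrev hℓ hrange
  have he : T₁' = T₁ := hd.satakeTransform_injective (by rw [hT₁', hT₁])
  obtain ⟨P, rfl⟩ := hgen T
  rw [he, ← aeval_algHom_apply, ← aeval_algHom_apply, h]

/-- **EVERY UNRAMIFIED CHARACTER IS A HECKE EIGENCHARACTER**: if `range 𝒮 = ℂ[Λ⁻]^W` for a line `Λ⁻`, every algebra
homomorphism `χ : ℋ(U(σ, J₀), K₀) → ℂ` is `λ_β` for some torus parameter `β` (indeed `β = (z, 1, …, 1)` with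
`z + z⁻¹ = χ(T₁)`). [cite: CartierCorvallis1979, §IV Cor. 4.2] [cite: Rogawski1990, §4.5 p. 50] [cite: Minguez2011, §4] -/
theorem exists_heckeEigencharacter_eq_of_range_eq
    (χ : heckeAlgebra ℂ (unitaryGroupOfForm σ ((StdForm.antidiagonal N).over K)) (unitaryInt σ ((StdForm.antidiagonal N).over K)) →ₐ[ℂ] ℂ) :
    ∃ β : Fin N → ℂˣ, hd.heckeEigencharacter β = χ := by
  obtain ⟨T₁, hT₁, -⟩ := hd.exists_aeval_eq_of_range_eq hadd hℓ0 hℓrev hℓ hrange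
  obtain ⟨z, hz⟩ := exists_units_add_inv_eq (χ T₁)
  refine ⟨fun i => if i = 0 then z else 1, hd.algHom_ext_of_range_eq hadd hℓ0 hℓrev hℓ hrange hT₁ ?_⟩
  rw [hd.heckeEigencharacter_apply_generator hadd hT₁, ← hz]
  have hprod : (∏ i : Fin N, (((if i = 0 then z else 1 : ℂˣ)) : ℂ) ^ ℓ 1 i) = z := by
    rw [Finset.prod_eq_single (0 : Fin N)]
    · rw [if_pos rfl, hℓ0, zpow_one]
    · intro i _ hi; rw [if_neg hi, Units.val_one, one_zpow]
    · intro h; exact absurd (Finset.mem_univ _) h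
  rw [hprod]

/-- **The fibres of `β ↦ λ_β` are the `W`-orbits**: `λ_β = λ_{β'}` iff `z(β') = z(β)` or `z(β') = z(β)⁻¹`, `z(β) = ∏_i β_i^{(ℓ_1)_i}`
— the unramified dual of `ℋ(U(σ, J₀), K₀)` is `ℂˣ/(z ∼ z⁻¹)`. [cite: CartierCorvallis1979, §IV Cor. 4.2] [cite: Rogawski1990, §2.3 p. 21, §4.5 p. 50] -/
theorem heckeEigencharacter_eq_iff_of_range_eq (β β' : Fin N → ℂˣ) :
    hd.heckeEigencharacter β = hd.heckeEigencharacter β' ↔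
      (∏ i, ((β' i : ℂ) ^ ℓ 1 i)) = ∏ i, ((β i : ℂ) ^ ℓ 1 i) ∨ (∏ i, ((β' i : ℂ) ^ ℓ 1 i)) = (∏ i, ((β i : ℂ) ^ ℓ 1 i))⁻¹ := by
  obtain ⟨T₁, hT₁, -⟩ := hd.exists_aeval_eq_of_range_eq hadd hℓ0 hℓrev hℓ hrange
  have hz : ∀ γ : Fin N → ℂˣ, (∏ i, ((γ i : ℂ) ^ ℓ 1 i)) ≠ 0 := fun γ =>
    Finset.prod_ne_zero_iff.2 fun i _ => zpow_ne_zero _ (γ i).ne_zero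
  constructor
  · intro h
    have h1 := congrArg (fun φ => φ T₁) h
    simp only [hd.heckeEigencharacter_apply_generator hadd hT₁] at h1
    exact eq_or_eq_inv_of_add_inv_eq (hz β) (hz β') h1
  · intro h
    refine hd.algHom_ext_of_range_eq hadd hℓ0 hℓrev hℓ hrange hT₁ ?_
    rw [hd.heckeEigencharacter_apply_generator hadd hT₁,
      hd.heckeEigencharacter_apply_generator hadd hT₁]
    rcases h with h | h
    · rw [h]
    · rw [h, inv_inv, add_comm]

end Abstract

/-! ## §3 `U(3)` and `U(2)` -/

section Three

variable [Finite 𝓀[K]]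
  [IsHeckeTriple (⊤ : Submonoid (unitaryGroupOfForm σ ((StdForm.antidiagonal 3).over K))) (unitaryInt σ ((StdForm.antidiagonal 3).over K))
    (unitaryInt σ ((StdForm.antidiagonal 3).over K))]

/-- The line of `U(3)`, `ℓ_m = (m, 0, -m)`, is additive. [folklore] -/
private theorem linear_three_add (a b : ℤ) :
    (fun i : Fin 3 => (a + b) * (1 - (i : ℕ))) = (fun i : Fin 3 => a * (1 - (i : ℕ))) + fun i : Fin 3 => b * (1 - (i : ℕ)) := by
  funext i; simp only [Pi.add_apply]; ring

/-- **EVERY UNRAMIFIED CHARACTER OF `ℋ(U(3), K₀)` IS A HECKE EIGENCHARACTER `λ_β`** (`σ ≠ id`).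
[cite: CartierCorvallis1979, §IV Cor. 4.2] [cite: Rogawski1990, §4.5 p. 50] [cite: Minguez2011, §4] -/
theorem exists_heckeEigencharacter_eq_three (hd : UnramifiedLocalConjDatum σ ϖ) (hσ : ∃ x : K, σ x ≠ x)
    (χ : heckeAlgebra ℂ (unitaryGroupOfForm σ ((StdForm.antidiagonal 3).over K)) (unitaryInt σ ((StdForm.antidiagonal 3).over K)) →ₐ[ℂ] ℂ) :
    ∃ β : Fin 3 → ℂˣ, hd.heckeEigencharacter β = χ :=
  hd.exists_heckeEigencharacter_eq_of_range_eq (ℓ := fun m (i : Fin 3) => m * (1 - (i : ℕ))) linear_three_add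
    (fun m => by show m * (1 - ((0 : ℕ) : ℤ)) = m; ring) rev_linear_three eq_linear_three_of_rev
    (hd.range_satakeTransform_unitary_three hσ) χ

/-- **`λ_β = λ_{β'}` on `ℋ(U(3), K₀)` iff `β'₀/β'₂ = β₀/β₂` or `β'₀/β'₂ = (β₀/β₂)⁻¹`** (the Satake parameter `z = β₀ β₂⁻¹` up to
`z ↦ z⁻¹`). [cite: CartierCorvallis1979, §IV Cor. 4.2] [cite: Rogawski1990, §2.3 p. 21, §4.5 p. 50] -/
theorem heckeEigencharacter_eq_iff_three (hd : UnramifiedLocalConjDatum σ ϖ) (hσ : ∃ x : K, σ x ≠ x) (β β' : Fin 3 → ℂˣ) :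
    hd.heckeEigencharacter β = hd.heckeEigencharacter β' ↔
      (β' 0 : ℂ) * (β' 2 : ℂ)⁻¹ = (β 0 : ℂ) * (β 2 : ℂ)⁻¹ ∨ (β' 0 : ℂ) * (β' 2 : ℂ)⁻¹ = ((β 0 : ℂ) * (β 2 : ℂ)⁻¹)⁻¹ := by
  have h := hd.heckeEigencharacter_eq_iff_of_range_eq (ℓ := fun m (i : Fin 3) => m * (1 - (i : ℕ))) linear_three_add
    (fun m => by show m * (1 - ((0 : ℕ) : ℤ)) = m; ring) rev_linear_three eq_linear_three_of_rev
    (hd.range_satakeTransform_unitary_three hσ) β β'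
  have hz : ∀ γ : Fin 3 → ℂˣ, (∏ i : Fin 3, ((γ i : ℂ) ^ ((1 : ℤ) * (1 - ((i : ℕ) : ℤ))))) = (γ 0 : ℂ) * (γ 2 : ℂ)⁻¹ := fun γ => by
    rw [Fin.prod_univ_three]
    simp only [Fin.val_zero, Fin.val_one, Fin.val_two, Nat.cast_zero, Nat.cast_one, Nat.cast_ofNat, sub_zero, sub_self, mul_one,
      one_mul, mul_zero, zpow_one, zpow_zero, show (1 : ℤ) - 2 = -1 by norm_num, zpow_neg]
  rw [hz, hz] at h
  exact h

/-- **`ℋ(U(3), K₀) = ℂ[T₁]`**: there is a Hecke operator `T₁` (with `𝒮(T₁) = x^{(1,0,-1)} + x^{(-1,0,1)}`) such that every `T` is a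
polynomial in `T₁`. [cite: CartierCorvallis1979, §IV Thm. 4.1] [cite: Satake1963, §§6–7] -/
theorem exists_generator_three (hd : UnramifiedLocalConjDatum σ ϖ) (hσ : ∃ x : K, σ x ≠ x) :
    ∃ T₁ : heckeAlgebra ℂ (unitaryGroupOfForm σ ((StdForm.antidiagonal 3).over K)) (unitaryInt σ ((StdForm.antidiagonal 3).over K)),
      hd.satakeTransform T₁ = AddMonoidAlgebra.single (fun i : Fin 3 => (1 : ℤ) * (1 - (i : ℕ))) (1 : ℂ) +
        AddMonoidAlgebra.single (fun i : Fin 3 => (-1 : ℤ) * (1 - (i : ℕ))) 1 ∧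
      ∀ T, ∃ P : ℂ[X], aeval T₁ P = T :=
  hd.exists_aeval_eq_of_range_eq (ℓ := fun m (i : Fin 3) => m * (1 - (i : ℕ))) linear_three_add
    (fun m => by show m * (1 - ((0 : ℕ) : ℤ)) = m; ring) rev_linear_three eq_linear_three_of_rev
    (hd.range_satakeTransform_unitary_three hσ)

end Three

section Two

variable [Finite 𝓀[K]]
  [IsHeckeTriple (⊤ : Submonoid (unitaryGroupOfForm σ ((StdForm.antidiagonal 2).over K))) (unitaryInt σ ((StdForm.antidiagonal 2).over K))
    (unitaryInt σ ((StdForm.antidiagonal 2).over K))]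

/-- The line of `U(2)`, `ℓ_m = (m, -m)`, is additive. [folklore] -/
private theorem linear_two_add (a b : ℤ) :
    (fun i : Fin 2 => (a + b) * (1 - 2 * (i : ℕ))) = (fun i : Fin 2 => a * (1 - 2 * (i : ℕ))) + fun i : Fin 2 => b * (1 - 2 * (i : ℕ)) := by
  funext i; simp only [Pi.add_apply]; ring

/-- **EVERY UNRAMIFIED CHARACTER OF `ℋ(U(2), K₀)` IS A HECKE EIGENCHARACTER `λ_β`** (`σ ≠ id`).
[cite: CartierCorvallis1979, §IV Cor. 4.2] [cite: Rogawski1990, §4.5 p. 50] [cite: Minguez2011, §4] -/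
theorem exists_heckeEigencharacter_eq_two (hd : UnramifiedLocalConjDatum σ ϖ) (hσ : ∃ x : K, σ x ≠ x)
    (χ : heckeAlgebra ℂ (unitaryGroupOfForm σ ((StdForm.antidiagonal 2).over K)) (unitaryInt σ ((StdForm.antidiagonal 2).over K)) →ₐ[ℂ] ℂ) :
    ∃ β : Fin 2 → ℂˣ, hd.heckeEigencharacter β = χ :=
  hd.exists_heckeEigencharacter_eq_of_range_eq (ℓ := fun m (i : Fin 2) => m * (1 - 2 * (i : ℕ))) linear_two_add
    (fun m => by show m * (1 - 2 * ((0 : ℕ) : ℤ)) = m; ring) rev_linear_two eq_linear_two_of_rev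
    (hd.range_satakeTransform_unitary_two hσ) χ

/-- **`λ_β = λ_{β'}` on `ℋ(U(2), K₀)` iff `β'₀/β'₁ = β₀/β₁` or `β'₀/β'₁ = (β₀/β₁)⁻¹`**.
[cite: CartierCorvallis1979, §IV Cor. 4.2] [cite: Rogawski1990, §2.3 p. 21, §4.5 p. 50] -/
theorem heckeEigencharacter_eq_iff_two (hd : UnramifiedLocalConjDatum σ ϖ) (hσ : ∃ x : K, σ x ≠ x) (β β' : Fin 2 → ℂˣ) :
    hd.heckeEigencharacter β = hd.heckeEigencharacter β' ↔
      (β' 0 : ℂ) * (β' 1 : ℂ)⁻¹ = (β 0 : ℂ) * (β 1 : ℂ)⁻¹ ∨ (β' 0 : ℂ) * (β' 1 : ℂ)⁻¹ = ((β 0 : ℂ) * (β 1 : ℂ)⁻¹)⁻¹ := by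
  have h := hd.heckeEigencharacter_eq_iff_of_range_eq (ℓ := fun m (i : Fin 2) => m * (1 - 2 * (i : ℕ))) linear_two_add
    (fun m => by show m * (1 - 2 * ((0 : ℕ) : ℤ)) = m; ring) rev_linear_two eq_linear_two_of_rev
    (hd.range_satakeTransform_unitary_two hσ) β β'
  have hz : ∀ γ : Fin 2 → ℂˣ, (∏ i : Fin 2, ((γ i : ℂ) ^ ((1 : ℤ) * (1 - 2 * ((i : ℕ) : ℤ))))) = (γ 0 : ℂ) * (γ 1 : ℂ)⁻¹ := fun γ => by
    rw [Fin.prod_univ_two]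
    simp only [Fin.val_zero, Fin.val_one, Nat.cast_zero, Nat.cast_one, mul_zero, sub_zero, mul_one, one_mul,
      show (1 : ℤ) - 2 = -1 by norm_num, zpow_neg, zpow_one]
  rw [hz, hz] at h
  exact h

/-- **`ℋ(U(2), K₀) = ℂ[T₁]`**: every `T` is a polynomial in one Hecke operator `T₁` (`𝒮(T₁) = x^{(1,-1)} + x^{(-1,1)}`).
[cite: CartierCorvallis1979, §IV Thm. 4.1] [cite: Satake1963, §§6–7] -/
theorem exists_generator_two (hd : UnramifiedLocalConjDatum σ ϖ) (hσ : ∃ x : K, σ x ≠ x) :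
    ∃ T₁ : heckeAlgebra ℂ (unitaryGroupOfForm σ ((StdForm.antidiagonal 2).over K)) (unitaryInt σ ((StdForm.antidiagonal 2).over K)),
      hd.satakeTransform T₁ = AddMonoidAlgebra.single (fun i : Fin 2 => (1 : ℤ) * (1 - 2 * (i : ℕ))) (1 : ℂ) +
        AddMonoidAlgebra.single (fun i : Fin 2 => (-1 : ℤ) * (1 - 2 * (i : ℕ))) 1 ∧
      ∀ T, ∃ P : ℂ[X], aeval T₁ P = T :=
  hd.exists_aeval_eq_of_range_eq (ℓ := fun m (i : Fin 2) => m * (1 - 2 * (i : ℕ))) linear_two_add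
    (fun m => by show m * (1 - 2 * ((0 : ℕ) : ℤ)) = m; ring) rev_linear_two eq_linear_two_of_rev
    (hd.range_satakeTransform_unitary_two hσ)

end Two

end UnramifiedLocalConjDatum

end Literature.NumberTheory.Automorphic.HermitianLattice

end
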